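import Mathlib
import Summits.Ventures.PercRepro2.Defs
import Summits.Ventures.PercRepro2.Independence
import Summits.Ventures.PercRepro2.Harris
import Summits.Ventures.PercRepro2.Graph
import Summits.Ventures.PercRepro2.Exploration
import Summits.Ventures.PercRepro2.Events
import Summits.Ventures.PercRepro2.FourFunctions
import Summits.Ventures.PercRepro2.Induced
import Summits.Ventures.PercRepro2.Frontier
import Summits.Ventures.PercRepro2.ObsIndependence
import Summits.Ventures.PercRepro2.BHK
import Summits.Ventures.PercRepro2.BHKEvents
import Summits.Ventures.PercRepro2.SideAgreement
import Summits.Ventures.PercRepro2.VdBKahn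
import Summits.Ventures.PercRepro2.BHKAvoid
import Summits.Ventures.PercRepro2.R2PrimeThreeReduction
import Summits.Ventures.PercRepro2.YBridge
import Summits.Ventures.PercRepro2.Yu1Functionals
import Summits.Ventures.PercRepro2.Yu1Events
import Summits.Ventures.PercRepro2.Yu1
import Summits.Ventures.PercRepro2.LBSplit
import Summits.Ventures.PercRepro2.YDelta
import Summits.Ventures.PercRepro2.SD
import Summits.Ventures.PercRepro2.Threshold
import Summits.Ventures.PercRepro2.Lambda
import Summits.Ventures.PercRepro2.LambdaTau
import Summits.Ventures.PercRepro2.LambdaSlack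
import Summits.Ventures.PercRepro2.HF2
import Summits.Ventures.PercRepro2.Yu2
import Summits.Ventures.PercRepro2.N0
import Summits.Ventures.PercRepro2.Y
import Summits.Ventures.PercRepro2.YDeltaTools
import Summits.Ventures.PercRepro2.ZDelta
import Summits.Ventures.PercRepro2.ZExpand
import Summits.Ventures.PercRepro2.ISplit
import Summits.Ventures.PercRepro2.MRl
import Summits.Ventures.PercRepro2.ZOloc
import Summits.Ventures.PercRepro2.SideBridge

/-!
# The covariance form (HCOV) and the margin theorem: `ZDelta ⟸ HCov` (blind cell PercRepro2,
typer-1; lead g9 `LEAD-PROOFSHAPES.md` §8.9 ADDENDA 19–20, PRIORITY ask 2026-08-23T05:18:00Z)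

Under `Q = {a₁ ↮ a₂}` (`avoidAll a₂ {a₁}`) with the side signs `σ_v = 1_{v ∈ C₁} − 1_{v ∈ C₂}`, the
worlds `PD = Q ∩ {a₃ ∉ U}`, `T = Q ∩ {a₃ ∈ C₂}`, `T′ = Q ∩ {a₃ ∈ C₁}` (`Q = PD ⊔ T ⊔ T′`, `Qsplit`),
`D = P(PD)`, `D_o = P(PD, o ∈ U)`, `γ = D_o / D`, `F = σ_o + σ₃ (γ − 1_{o ∈ U})`, `gap = P(a₂ ↔ b) − P(a₁ ↔ b)`,
everything is kept DIVISION-FREE (cleared by `D` and `P(Q)`; ref-1's note: `γ` is junk at `D = 0`):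

* the `σ`-moments as signed pattern sums: `EQbo = E_Q[σ_b σ_o]` (`= sameSide − oppSide`),
  `EQb3 = E_Q[σ_b σ₃]`, `EQb3o = E_Q[σ_b σ₃ 1_{o∈U}]`, `EQo`, `EQ3`, `EQ3o`, `PDb = P(PD, b ∈ U)`,
  `PDbo = P(PD, b ∈ U, o ∈ U)`; `DEF = D · E_Q[F]`;
* **`Gc`** `= D · P(Q) · G` with `G = P(Q) Cov_μ(σ_b, F) − D Cov_PD(1_{b∈U}, 1_{o∈U})` (ADDENDUM 19 (2));
  **`HCov := 0 ≤ Gc`** (row 2′HCOV: labelling-free, `l ↔ h` symmetric; census 0 / 10,080 (n = 5),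
  0 / 161,280 (n = 6 full));
* **`marginC`** `= D_o P(Q) − D · E_Q[F]` (`= D P(Q) (γ − E_μ F)`); **`margin_identity`**:
  `marginC = 2 [D_o P(T) − D P(T, oL)] + 2 D P(PD, oH) + 2 D P(T′, oH)` and **`margin_nonneg`**
  (THEOREM (MARGIN), ADDENDUM 20 (2)): `0 ≤ marginC`, by `bhk_cross_cluster_avoid` (BHK06 Thm 1.4,
  `s = a₁`, `t = a₂`, `X = {a₂, a₃}`, up-sets `{o ∈ ·}`, `{a₃ ∈ ·}`): `P(T, oL) · D ≤ P(PD, oL) · P(T)`;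
* **`two_Z_eq`**: `2 P(Q) · Z = Gc + gap · marginC` (the cleared ADDENDUM 19 identity
  `2Z/D = G + gap (γ − E_μ F)`) — a linear identity in the pattern masses after `Qsplit`;
* **`ZDelta_of_HCov`**: `HCov → ZDelta` for every labelled instance — the chain of record
  (ZΔ) ⟸ (HCOV), no tie and no polarisation induction.
-/

namespace Summit.Ventures.PercRepro2

open UnionCluster

namespace CovForm

section Defs

variable {V : Type*} {E : Type*} [Fintype E] [DecidableEq E] [DecidableEq V] {R : Type*}
  [Field R] [LinearOrder R]

/-- `E_Q[σ_b σ_o] = P(Q, oL, bL) + P(Q, oH, bH) − P(Q, oH, bL) − P(Q, oL, bH)`. -/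
noncomputable def EQbo (p : E → R) (ends : E → Sym2 V) (o a₁ a₂ b : V) : R :=
  prob p (avoidAll ends a₂ {a₁} ∩ (connEvent ends a₁ o ∩ connEvent ends a₁ b)) +
    prob p (avoidAll ends a₂ {a₁} ∩ (connEvent ends a₂ o ∩ connEvent ends a₂ b)) -
    prob p (avoidAll ends a₂ {a₁} ∩ (connEvent ends a₂ o ∩ connEvent ends a₁ b)) -
    prob p (avoidAll ends a₂ {a₁} ∩ (connEvent ends a₁ o ∩ connEvent ends a₂ b))

/-- `E_Q[σ_b σ₃] = P(T′, bL) + P(T, bH) − P(T, bL) − P(T′, bH)`. -/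
noncomputable def EQb3 (p : E → R) (ends : E → Sym2 V) (a₁ a₂ a₃ b : V) : R :=
  prob p (TEvent ends a₂ a₁ a₃ ∩ connEvent ends a₁ b) +
    prob p (TEvent ends a₁ a₂ a₃ ∩ connEvent ends a₂ b) -
    prob p (TEvent ends a₁ a₂ a₃ ∩ connEvent ends a₁ b) -
    prob p (TEvent ends a₂ a₁ a₃ ∩ connEvent ends a₂ b)

/-- `E_Q[σ_b σ₃ 1_{o ∈ U}]`. -/
noncomputable def EQb3o (p : E → R) (ends : E → Sym2 V) (o a₁ a₂ a₃ b : V) : R :=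
  prob p (TEvent ends a₂ a₁ a₃ ∩ (connEvent ends a₁ o ∩ connEvent ends a₁ b)) +
    prob p (TEvent ends a₂ a₁ a₃ ∩ (connEvent ends a₂ o ∩ connEvent ends a₁ b)) +
    prob p (TEvent ends a₁ a₂ a₃ ∩ (connEvent ends a₁ o ∩ connEvent ends a₂ b)) +
    prob p (TEvent ends a₁ a₂ a₃ ∩ (connEvent ends a₂ o ∩ connEvent ends a₂ b)) -
    prob p (TEvent ends a₁ a₂ a₃ ∩ (connEvent ends a₁ o ∩ connEvent ends a₁ b)) -
    prob p (TEvent ends a₁ a₂ a₃ ∩ (connEvent ends a₂ o ∩ connEvent ends a₁ b)) -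
    prob p (TEvent ends a₂ a₁ a₃ ∩ (connEvent ends a₁ o ∩ connEvent ends a₂ b)) -
    prob p (TEvent ends a₂ a₁ a₃ ∩ (connEvent ends a₂ o ∩ connEvent ends a₂ b))

/-- `E_Q[σ_o] = P(Q, oL) − P(Q, oH)`. -/
noncomputable def EQo (p : E → R) (ends : E → Sym2 V) (o a₁ a₂ : V) : R :=
  prob p (avoidAll ends a₂ {a₁} ∩ connEvent ends a₁ o) -
    prob p (avoidAll ends a₂ {a₁} ∩ connEvent ends a₂ o)

/-- `E_Q[σ₃] = P(T′) − P(T)`. -/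
noncomputable def EQ3 (p : E → R) (ends : E → Sym2 V) (a₁ a₂ a₃ : V) : R :=
  prob p (TEvent ends a₂ a₁ a₃) - prob p (TEvent ends a₁ a₂ a₃)

/-- `E_Q[σ₃ 1_{o ∈ U}] = P(T′, oL) + P(T′, oH) − P(T, oL) − P(T, oH)`. -/
noncomputable def EQ3o (p : E → R) (ends : E → Sym2 V) (o a₁ a₂ a₃ : V) : R :=
  prob p (TEvent ends a₂ a₁ a₃ ∩ connEvent ends a₁ o) +
    prob p (TEvent ends a₂ a₁ a₃ ∩ connEvent ends a₂ o) -
    prob p (TEvent ends a₁ a₂ a₃ ∩ connEvent ends a₁ o) -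
    prob p (TEvent ends a₁ a₂ a₃ ∩ connEvent ends a₂ o)

/-- `P(PD, b ∈ U)`. -/
noncomputable def PDb (p : E → R) (ends : E → Sym2 V) (a₁ a₂ a₃ b : V) : R :=
  prob p (PDEvent ends a₁ a₂ a₃ ∩ connEvent ends a₁ b) +
    prob p (PDEvent ends a₁ a₂ a₃ ∩ connEvent ends a₂ b)

/-- `P(PD, b ∈ U, o ∈ U)`. -/
noncomputable def PDbo (p : E → R) (ends : E → Sym2 V) (o a₁ a₂ a₃ b : V) : R :=
  prob p (PDEvent ends a₁ a₂ a₃ ∩ (connEvent ends a₁ o ∩ connEvent ends a₁ b)) +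
    prob p (PDEvent ends a₁ a₂ a₃ ∩ (connEvent ends a₂ o ∩ connEvent ends a₁ b)) +
    prob p (PDEvent ends a₁ a₂ a₃ ∩ (connEvent ends a₁ o ∩ connEvent ends a₂ b)) +
    prob p (PDEvent ends a₁ a₂ a₃ ∩ (connEvent ends a₂ o ∩ connEvent ends a₂ b))

/-- `D_o = P(PD, o ∈ U)`. -/
noncomputable def Do (p : E → R) (ends : E → Sym2 V) (o a₁ a₂ a₃ : V) : R :=
  prob p (PDEvent ends a₁ a₂ a₃ ∩ connEvent ends a₁ o) +
    prob p (PDEvent ends a₁ a₂ a₃ ∩ connEvent ends a₂ o)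

/-- The labelling gap `P(a₂ ↔ b) − P(a₁ ↔ b)`. -/
noncomputable def gap (p : E → R) (ends : E → Sym2 V) (a₁ a₂ b : V) : R :=
  prob p (connEvent ends a₂ b) - prob p (connEvent ends a₁ b)

/-- `D · E_Q[F] = D E_Q[σ_o] + D_o E_Q[σ₃] − D E_Q[σ₃ 1_{o∈U}]`. -/
noncomputable def DEF (p : E → R) (ends : E → Sym2 V) (o a₁ a₂ a₃ : V) : R :=
  prob p (PDEvent ends a₁ a₂ a₃) * EQo p ends o a₁ a₂ + Do p ends o a₁ a₂ a₃ * EQ3 p ends a₁ a₂ a₃ -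
    prob p (PDEvent ends a₁ a₂ a₃) * EQ3o p ends o a₁ a₂ a₃

/-- **`Gc = D · P(Q) · G`** (ADDENDUM 19 (2), cleared):
`P(Q)·[D E_Q[σ_b σ_o] + D_o E_Q[σ_b σ₃] − D E_Q[σ_b σ₃ 1_{o∈U}]] + gap · D E_Q[F] + P(Q)·[D_o P(PD,b∈U) − D P(PD,b∈U,o∈U)]`. -/
noncomputable def Gc (p : E → R) (ends : E → Sym2 V) (o a₁ a₂ a₃ b : V) : R :=
  prob p (avoidAll ends a₂ {a₁}) *
      (prob p (PDEvent ends a₁ a₂ a₃) * EQbo p ends o a₁ a₂ b +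
        Do p ends o a₁ a₂ a₃ * EQb3 p ends a₁ a₂ a₃ b -
        prob p (PDEvent ends a₁ a₂ a₃) * EQb3o p ends o a₁ a₂ a₃ b) +
    gap p ends a₁ a₂ b * DEF p ends o a₁ a₂ a₃ +
    prob p (avoidAll ends a₂ {a₁}) *
      (Do p ends o a₁ a₂ a₃ * PDb p ends a₁ a₂ a₃ b -
        prob p (PDEvent ends a₁ a₂ a₃) * PDbo p ends o a₁ a₂ a₃ b)

/-- **(HCOV)** (row 2′HCOV): `0 ≤ Gc`, i.e. `G ≥ 0` when `D, P(Q) > 0` (labelling-free). -/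
def HCov (p : E → R) (ends : E → Sym2 V) (o a₁ a₂ a₃ b : V) : Prop :=
  0 ≤ Gc p ends o a₁ a₂ a₃ b

/-- **The cleared margin** `D_o P(Q) − D · E_Q[F]` (`= D P(Q) (γ − E_μ F)`). -/
noncomputable def marginC (p : E → R) (ends : E → Sym2 V) (o a₁ a₂ a₃ : V) : R :=
  Do p ends o a₁ a₂ a₃ * prob p (avoidAll ends a₂ {a₁}) - DEF p ends o a₁ a₂ a₃

end Defs

section Closure

variable (R : Type*) [Field R] [LinearOrder R] [IsStrictOrderedRing R]

/-- **(HCOV) for every finite graph** (labelling-free). -/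
def HCov_all : Prop :=
  ∀ (V E : Type) [Fintype V] [DecidableEq V] [Fintype E] [DecidableEq E]
    (ends : E → Sym2 V) (p : E → R), IsProbVec p →
    ∀ o a₁ a₂ a₃ b : V, a₁ ≠ a₂ → a₁ ≠ a₃ → a₂ ≠ a₃ → o ≠ a₁ → o ≠ a₂ → o ≠ a₃ → o ≠ b →
      b ≠ a₁ → b ≠ a₂ → b ≠ a₃ → HCov p ends o a₁ a₂ a₃ b

end Closure

section Splits

variable {V : Type*} {E : Type*} [Fintype E] [DecidableEq E] [DecidableEq V] {R : Type*}
  [Field R] [LinearOrder R] [IsStrictOrderedRing R]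

omit [LinearOrder R] [IsStrictOrderedRing R] in
/-- **`Q = PD ⊔ T ⊔ T′`** on any event `X`. -/
lemma Qsplit (p : E → R) (ends : E → Sym2 V) (a₁ a₂ a₃ : V) (X : Set (Config E)) :
    prob p (avoidAll ends a₂ {a₁} ∩ X) =
      prob p (PDEvent ends a₁ a₂ a₃ ∩ X) + prob p (TEvent ends a₁ a₂ a₃ ∩ X) +
        prob p (TEvent ends a₂ a₁ a₃ ∩ X) := by
  have h1 := ISplit.prob_PD_add_T p ends a₁ a₂ a₃ X
  have h2 := ZOloc.prob_R_add_Tp p ends a₁ a₂ a₃ X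
  linear_combination -h1 - h2

omit [LinearOrder R] [IsStrictOrderedRing R] in
/-- `P(Q) = D + P(T) + P(T′)`. -/
lemma Qsplit_univ (p : E → R) (ends : E → Sym2 V) (a₁ a₂ a₃ : V) :
    prob p (avoidAll ends a₂ {a₁}) =
      prob p (PDEvent ends a₁ a₂ a₃) + prob p (TEvent ends a₁ a₂ a₃) +
        prob p (TEvent ends a₂ a₁ a₃) := by
  have h := Qsplit p ends a₁ a₂ a₃ Set.univ
  simpa only [Set.inter_univ] using h

omit [DecidableEq V] in
/-- `gap = P(Q, bH) − P(Q, bL)` (on `Qᶜ` the two connections coincide). -/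
lemma gap_eq_Q (p : E → R) (ends : E → Sym2 V) (a₁ a₂ b : V) :
    gap p ends a₁ a₂ b =
      prob p (avoidAll ends a₂ {a₁} ∩ connEvent ends a₂ b) -
        prob p (avoidAll ends a₂ {a₁} ∩ connEvent ends a₁ b) := by
  have h := prob_conn_sub_eq_Q_sub p ends a₁ a₂ b
  simp only [SideBridge.inter_compl_conn_eq'] at h
  unfold gap
  linear_combination -h

end Splits

section Margin

variable {V : Type*} {E : Type*} [Fintype E] [DecidableEq E] [Fintype V] [DecidableEq V]
  {R : Type*} [Field R] [LinearOrder R] [IsStrictOrderedRing R]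

omit [Fintype V] [LinearOrder R] [IsStrictOrderedRing R] in
/-- **The margin identity** (ADDENDUM 20 (1), cleared):
`marginC = 2 [D_o P(T) − D P(T, oL)] + 2 D P(PD, oH) + 2 D P(T′, oH)`. -/
theorem margin_identity (p : E → R) (ends : E → Sym2 V) (o a₁ a₂ a₃ : V) :
    marginC p ends o a₁ a₂ a₃ =
      2 * (Do p ends o a₁ a₂ a₃ * prob p (TEvent ends a₁ a₂ a₃) -
          prob p (PDEvent ends a₁ a₂ a₃) * prob p (TEvent ends a₁ a₂ a₃ ∩ connEvent ends a₁ o)) +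
        2 * prob p (PDEvent ends a₁ a₂ a₃) * prob p (PDEvent ends a₁ a₂ a₃ ∩ connEvent ends a₂ o) +
        2 * prob p (PDEvent ends a₁ a₂ a₃) * prob p (TEvent ends a₂ a₁ a₃ ∩ connEvent ends a₂ o) := by
  unfold marginC DEF EQo EQ3 EQ3o Do
  rw [Qsplit_univ p ends a₁ a₂ a₃, Qsplit p ends a₁ a₂ a₃ (connEvent ends a₁ o),
    Qsplit p ends a₁ a₂ a₃ (connEvent ends a₂ o)]
  ring

omit [Fintype E] [DecidableEq E] [Fintype V] [LinearOrder R] [IsStrictOrderedRing R] in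
/-- `{o ∈ C₁} ∩ {a₂ ↔ a₃} ∩ R = T ∩ {o ∈ C₁}`. -/
lemma oL_inter_conn_inter_R (ends : E → Sym2 V) (o a₁ a₂ a₃ : V) :
    connEvent ends a₁ o ∩ connEvent ends a₂ a₃ ∩ avoidAll ends a₁ {a₂, a₃} =
      TEvent ends a₁ a₂ a₃ ∩ connEvent ends a₁ o := by
  ext ω
  simp only [Set.mem_inter_iff, mem_connEvent, mem_avoidAll, Finset.mem_insert,
    Finset.mem_singleton, forall_eq_or_imp, forall_eq, TEvent, Set.mem_compl_iff]
  constructor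
  · rintro ⟨⟨ho, h23⟩, h12, _⟩
    exact ⟨⟨fun h => h12 (conn_symm h), h23⟩, ho⟩
  · rintro ⟨⟨h21, h23⟩, ho⟩
    exact ⟨⟨ho, h23⟩, fun h => h21 (conn_symm h), fun h => h21 (conn_trans h23 (conn_symm h))⟩

omit [Fintype E] [DecidableEq E] [Fintype V] [LinearOrder R] [IsStrictOrderedRing R] in
/-- `{a₂ ↔ a₃} ∩ R = T`. -/
lemma conn_inter_R (ends : E → Sym2 V) (a₁ a₂ a₃ : V) :
    connEvent ends a₂ a₃ ∩ avoidAll ends a₁ {a₂, a₃} = TEvent ends a₁ a₂ a₃ := by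
  ext ω
  simp only [Set.mem_inter_iff, mem_connEvent, mem_avoidAll, Finset.mem_insert,
    Finset.mem_singleton, forall_eq_or_imp, forall_eq, TEvent, Set.mem_compl_iff]
  constructor
  · rintro ⟨h23, h12, _⟩
    exact ⟨fun h => h12 (conn_symm h), h23⟩
  · rintro ⟨h21, h23⟩
    exact ⟨h23, fun h => h21 (conn_symm h), fun h => h21 (conn_trans h23 (conn_symm h))⟩

/-- **(C2)** (ADDENDUM 20 (2), `bhk_cross_cluster_avoid` with `s = a₁`, `t = a₂`, `X = {a₂, a₃}`):
`P(T, oL) · D ≤ P(PD, oL) · P(T)`. -/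
theorem ToL_mul_D_le (p : E → R) (hp : IsProbVec p) (ends : E → Sym2 V) (o a₁ a₂ a₃ : V) :
    prob p (TEvent ends a₁ a₂ a₃ ∩ connEvent ends a₁ o) * prob p (PDEvent ends a₁ a₂ a₃) ≤
      prob p (PDEvent ends a₁ a₂ a₃ ∩ connEvent ends a₁ o) * prob p (TEvent ends a₁ a₂ a₃) := by
  have h := bhk_cross_cluster_avoid p hp ends a₁ a₂ (X := {a₂, a₃}) (Finset.mem_insert_self a₂ {a₃})
    (isUpperSet_mem_setOf o) (isUpperSet_mem_setOf a₃)
  rw [← connEvent_eq_clusterInEvent ends a₁ o, ← connEvent_eq_clusterInEvent ends a₂ a₃,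
    oL_inter_conn_inter_R, conn_inter_R] at h
  -- `P(R) = D + P(T)` and `P(oL, R) = P(PD, oL) + P(T, oL)`
  have hR := ISplit.prob_PD_add_T p ends a₁ a₂ a₃ Set.univ
  simp only [Set.inter_univ] at hR
  have hoR := ISplit.prob_PD_add_T p ends a₁ a₂ a₃ (connEvent ends a₁ o)
  have e : connEvent ends a₁ o ∩ avoidAll ends a₁ {a₂, a₃} =
      avoidAll ends a₁ {a₂, a₃} ∩ connEvent ends a₁ o := Set.inter_comm _ _
  rw [e, ← hoR, ← hR] at h
  nlinarith [h]

/-- **THEOREM (MARGIN)** (ADDENDUM 20 (2)): `0 ≤ marginC`, i.e. `γ ≥ E_μ F`. -/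
theorem margin_nonneg (p : E → R) (hp : IsProbVec p) (ends : E → Sym2 V) (o a₁ a₂ a₃ : V) :
    0 ≤ marginC p ends o a₁ a₂ a₃ := by
  rw [margin_identity]
  have h := ToL_mul_D_le p hp ends o a₁ a₂ a₃
  have hD := prob_nonneg hp (PDEvent ends a₁ a₂ a₃)
  have hT := prob_nonneg hp (TEvent ends a₁ a₂ a₃)
  have hoH := prob_nonneg hp (PDEvent ends a₁ a₂ a₃ ∩ connEvent ends a₂ o)
  have hoH' := prob_nonneg hp (TEvent ends a₂ a₁ a₃ ∩ connEvent ends a₂ o)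
  have hDo : prob p (PDEvent ends a₁ a₂ a₃ ∩ connEvent ends a₁ o) ≤ Do p ends o a₁ a₂ a₃ := by
    unfold Do
    linarith
  have h2 : prob p (PDEvent ends a₁ a₂ a₃ ∩ connEvent ends a₁ o) * prob p (TEvent ends a₁ a₂ a₃) ≤
      Do p ends o a₁ a₂ a₃ * prob p (TEvent ends a₁ a₂ a₃) :=
    mul_le_mul_of_nonneg_right hDo hT
  nlinarith [h, h2, mul_nonneg hD hoH, mul_nonneg hD hoH']

end Margin

section Identity

variable {V : Type*} {E : Type*} [Fintype E] [DecidableEq E] [DecidableEq V] {R : Type*}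
  [Field R] [LinearOrder R] [IsStrictOrderedRing R]

/-- **The cleared ADDENDUM 19 identity**: `2 P(Q) · Z = Gc + gap · marginC`, `Z` the (ZΔ)-slack. -/
theorem two_Z_eq (p : E → R) (ends : E → Sym2 V) (o a₁ a₂ a₃ b : V) :
    2 * prob p (avoidAll ends a₂ {a₁}) *
        ((prob p (PDEvent ends a₁ a₂ a₃ ∩ connEvent ends a₁ o) +
              prob p (PDEvent ends a₁ a₂ a₃ ∩ connEvent ends a₂ o)) *
            (massM2 p ends a₁ a₂ a₃ b + deltaT p ends a₁ a₂ a₃ b) -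
          ((prob p (PDEvent ends a₁ a₂ a₃ ∩ connEvent ends a₁ o ∩ connEvent ends a₂ b) -
                deltaL p ends o a₁ a₂ a₃ b) +
              (prob p (PDEvent ends a₁ a₂ a₃ ∩ connEvent ends a₂ o ∩ connEvent ends a₁ b) -
                deltaH p ends o a₁ a₂ a₃ b)) * prob p (PDEvent ends a₁ a₂ a₃)) =
      Gc p ends o a₁ a₂ a₃ b + gap p ends a₁ a₂ b * marginC p ends o a₁ a₂ a₃ := by
  have hg := gap_eq_Q p ends a₁ a₂ b
  unfold Gc marginC DEF EQbo EQb3 EQb3o EQo EQ3 EQ3o PDb PDbo Do massM2 deltaT deltaL deltaH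
  rw [hg]
  rw [Set.inter_comm (connEvent ends a₂ b) (TEvent ends a₁ a₂ a₃),
    Set.inter_comm (connEvent ends a₁ b) (TEvent ends a₁ a₂ a₃)]
  simp only [Set.inter_assoc]
  simp only [Qsplit p ends a₁ a₂ a₃]
  ring

end Identity

section Chain

variable {V : Type*} {E : Type*} [Fintype E] [DecidableEq E] [Fintype V] [DecidableEq V]
  {R : Type*} [Field R] [LinearOrder R] [IsStrictOrderedRing R]

/-- **The chain of record: (ZΔ) ⟸ (HCOV)** for every labelled instance (ADDENDUM 20 (3)). -/
theorem ZDelta_of_HCov (p : E → R) (hp : IsProbVec p) (ends : E → Sym2 V) {o a₁ a₂ a₃ b : V}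
    (hord : prob p (connEvent ends a₁ b) ≤ prob p (connEvent ends a₂ b))
    (h : HCov p ends o a₁ a₂ a₃ b) : ZDelta p ends o a₁ a₂ a₃ b := by
  unfold HCov at h
  have hid := two_Z_eq p ends o a₁ a₂ a₃ b
  have hgap : 0 ≤ gap p ends a₁ a₂ b := by
    unfold gap
    linarith
  have hm := margin_nonneg p hp ends o a₁ a₂ a₃
  have hQ : 0 ≤ prob p (avoidAll ends a₂ {a₁}) := prob_nonneg hp _
  unfold ZDelta
  by_cases hQ0 : prob p (avoidAll ends a₂ {a₁}) = 0
  · -- `P(Q) = 0` forces `D = D_l = D_h = 0`: both sides vanish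
    have hPD : PDEvent ends a₁ a₂ a₃ ⊆ avoidAll ends a₂ {a₁} := by
      intro ω hω
      have := ISplit.PD_eq_R_inter ends a₁ a₂ a₃
      rw [this] at hω
      have hR := hω.1
      rw [ZOloc.R_eq_Q_inter] at hR
      exact hR.1
    have hD : prob p (PDEvent ends a₁ a₂ a₃) = 0 :=
      le_antisymm (hQ0 ▸ prob_mono hp hPD) (prob_nonneg hp _)
    have hDl : prob p (PDEvent ends a₁ a₂ a₃ ∩ connEvent ends a₁ o) = 0 :=
      le_antisymm (hD ▸ prob_mono hp Set.inter_subset_left) (prob_nonneg hp _)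
    have hDh : prob p (PDEvent ends a₁ a₂ a₃ ∩ connEvent ends a₂ o) = 0 :=
      le_antisymm (hD ▸ prob_mono hp Set.inter_subset_left) (prob_nonneg hp _)
    rw [hD, hDl, hDh]
    simp
  · have hQpos : 0 < prob p (avoidAll ends a₂ {a₁}) := lt_of_le_of_ne hQ (Ne.symm hQ0)
    have hpos : 0 ≤ Gc p ends o a₁ a₂ a₃ b + gap p ends a₁ a₂ b * marginC p ends o a₁ a₂ a₃ :=
      add_nonneg h (mul_nonneg hgap hm)
    rw [← hid] at hpos
    have h2 : 0 ≤ (prob p (PDEvent ends a₁ a₂ a₃ ∩ connEvent ends a₁ o) +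
              prob p (PDEvent ends a₁ a₂ a₃ ∩ connEvent ends a₂ o)) *
            (massM2 p ends a₁ a₂ a₃ b + deltaT p ends a₁ a₂ a₃ b) -
          ((prob p (PDEvent ends a₁ a₂ a₃ ∩ connEvent ends a₁ o ∩ connEvent ends a₂ b) -
                deltaL p ends o a₁ a₂ a₃ b) +
              (prob p (PDEvent ends a₁ a₂ a₃ ∩ connEvent ends a₂ o ∩ connEvent ends a₁ b) -
                deltaH p ends o a₁ a₂ a₃ b)) * prob p (PDEvent ends a₁ a₂ a₃) := by
      have h2Q : 0 < 2 * prob p (avoidAll ends a₂ {a₁}) := by linarith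
      exact (mul_nonneg_iff_of_pos_left h2Q).1 hpos
    linarith

end Chain

end CovForm

end Summit.Ventures.PercRepro2
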